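import Summits.AtomisticToContinuum.Crystallization.Theorems.PalmUnimodularRigidityMinimiserShellsExactResidual
import Summits.AtomisticToContinuum.Crystallization.Theorems.PalmUnimodularRigidityMinimiserShellsDeepBadPricingOfShellNoBoundary
import HarnessLib.Audit

/-!
# The Lennard-Jones hard-core periodic first-shell gap conjecture — the named open core of crux `MinimiserShells`

Route `PalmUnimodularRigidity`, crux `Summit.AtomisticToContinuum.Crystallization.Theses.PalmUnimodularRigidity.MinimiserShells`
(stmt-AtomisticToContinuum-9225), line `elastic-coarse-to-fine` r5 (leads c15–c17, 2026-08-17).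

Seventeen line leads, a strategist census (`Cruxes/MinimiserShells/STRATEGY-CENSUS.md`) and three disprover generations
reduced the crux to ONE statement and certified the reduction EXACT in the kernel:

  `MinimiserShells ↔ ∀ θ ∈ (0, 1/10], Residual.ShellGap θ`   (`ExactResidual.minimiserShells_iff_shellGapAll`, p149424).

The right-hand side is bulk energetic crystallization of three-dimensional Lennard-Jones 12-6 in (arbitrarily finely loosened)
periodic first-shell form on the `1/3`-hard-core class — an OPEN PROBLEM (Blanc–Lewin 2015, §2.3: "completely open in
dimension three"; Flatley–Theil 2015 need a three-body term for the finite analogue).  This file gives that statement a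
NAME, `LennardJonesShellGapConjecture`, tagged `@[conjecture]` (CONVENTIONS §4: an open conjecture is a `def … : Prop`, never a
theorem; `HarnessLib.Audit.Tags`: an obligation node under the home summit's `Theorems/`, provable / refutable by name, usable by
a route only as its own item or as the `conditional_on` premise of a conditional bridge), states it in LITERATURE VOCABULARY ONLY
(`PeriodicConfiguration`, `points`, `motif`, `energyPerParticle`, `lennardJones`, `ShellCloseTo`, `fccKissingPattern`,
`hcpKissingPattern`, `⨅`; no `Residual.*` / `LoadBearing.*` abbreviation inside the definition), and records, sorry-free:

* `lennardJonesShellGapConjecture_iff_shellGapAll` — it IS `∀ θ ∈ (0, 1/10], Residual.ShellGap θ` (unfolding + `count|((· − x) '' S) {w} ≠ 0 ↔ w + x ∈ S`);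
* `minimiserShells_iff_lennardJonesShellGapConjecture` — **the crux is equivalent to the conjecture** (p149424 / p123347);
* `minimiserShells_of_lennardJonesShellGapConjecture` — the glue a planner can cite as `--glue-by` when carrying the crux as a
  conditional bridge `--conditional-on Summit.AtomisticToContinuum.Crystallization.LennardJonesShellGapConjecture`;
* `lennardJonesShellGapConjecture_of_shellGap_zero` — the exact (`θ = 0`) gap implies it (`Residual.shellGap_mono`);
* `lennardJonesShellGapConjecture_iff_nat` — a countable family suffices: `↔ ∀ n : ℕ, Residual.ShellGap (1/(n+10))`.

Informal statement.  Let `e* = inf_Q e_LJ(Q)` over periodic configurations `Q = F + G` of `ℝ³` (`V_LJ(r) = r⁻¹²/12 − r⁻⁶/6`).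
Call a site `x` of `Q` *`θ`-loosely close-packed* if for some scale `a ∈ [9/10, 1]` the atoms `x + w ∈ Q`, `w ≠ 0`,
`‖w‖ ≤ (5/4 − θ)·a` are, after a linear isometry, matched one-to-one within `a/100 + θ` to the `a`-scaled FCC (cuboctahedron)
or HCP (anticuboctahedron) kissing pattern.  CONJECTURE: for every `θ ∈ (0, 1/10]` and `t > 0` there is `κ > 0` such that every
periodic `Q` with `1/3`-separated points in which at least `t·#F` motif sites are NOT `θ`-loosely close-packed has
`e_LJ(Q) ≥ e* + κ`.  Equivalently (this file + p149424): every minimising point-stationary hard-core law of LJ has almost surely an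
exactly (`a/100`, radius `5a/4`) close-packed root shell.  What is known (all in tree): every hypothesis of the crux is load-bearing
(`Theorems/MinimiserShells/Negative/*`); linear pricing of bad shells is capped at `c ≤ 4.4e-4` by 1 %-strained close packings and
contains the conjecture; every computed non-close-packed monatomic LJ phase (bcc, bct, σ, A15, C15, icosahedral clusters) lies
`≥ 1.7 %·|e*|` above relaxed hcp (uncertified numerics, census §Negation); no dual certificate is known in `d = 3`
(`Literature.Barriers.AtomisticToContinuum.CohnElkiesNotSharp3D`).  Nothing here asserts the conjecture.
-/

noncomputable section

open MeasureTheory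
open scoped ENNReal BigOperators Classical

namespace Summit.AtomisticToContinuum.Crystallization

open Literature.MathematicalPhysics.StatisticalMechanics (lennardJones PeriodicConfiguration)
open Literature.Geometry.DiscreteGeometry (ShellCloseTo fccKissingPattern hcpKissingPattern)
open Summit.AtomisticToContinuum.Crystallization.Theorems.PalmUnimodularRigidityMinimiserShells.ShellNoBoundary
  (count_restrict_image_sub_singleton_ne_zero_iff)
open Summit.AtomisticToContinuum.Crystallization.Theses.PalmUnimodularRigidity (MinimiserShells)
open Summit.AtomisticToContinuum.Crystallization.Theorems.MinimiserShells.Negative.LoadBearing (eStar)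
open Summit.AtomisticToContinuum.Crystallization.Theorems.PalmUnimodularRigidityMinimiserShells.Residual
  (ShellGap IsSepThird looseBadMotifCount LooseGoodShell rerooted shellGap_mono)
open Summit.AtomisticToContinuum.Crystallization.Theorems.PalmUnimodularRigidityMinimiserShells.ExactResidual
  (minimiserShells_iff_shellGapAll)

/-- **The Lennard-Jones hard-core periodic first-shell gap conjecture** (all loosenings `θ ∈ (0, 1/10]`): for every
`θ ∈ (0, 1/10]` and every `t > 0` there is `κ > 0` such that every periodic configuration `Q` of `ℝ³` with `1/3`-separated
points, in which at least `t·#motif` motif sites `x` fail the `θ`-loosened close-packing test — "for some scale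
`a ∈ [9/10, 1]`, the finite set of offsets `w ≠ 0` with `w + x ∈ Q.points` and `‖w‖ ≤ (5/4 − θ)·a` is `(a/100 + θ)`-matched,
after a linear isometry, to the `a`-scaled FCC or HCP kissing pattern" — has Lennard-Jones energy per particle at least
`(⨅_R e_LJ(R)) + κ`.  This is bulk energetic crystallization of three-dimensional Lennard-Jones 12-6 in loosened periodic
first-shell form, the kernel-certified open core of crux `MinimiserShells` of route `PalmUnimodularRigidity`
(`minimiserShells_iff_lennardJonesShellGapConjecture` below); the crystallization problem for Lennard-Jones in `d = 3` is open
(Blanc–Lewin 2015, §2.3), and this first-shell form is this programme's (route `PalmUnimodularRigidity`, 2026-08), not a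
published statement.  A `def`, never asserted.
[cite: BlancLewin2015, §2.3]
[status: open] -/
@[conjecture] def LennardJonesShellGapConjecture : Prop :=
  ∀ θ : ℝ, 0 < θ → θ ≤ 1 / 10 →
  ∀ t : ℝ, 0 < t → ∃ κ : ℝ, 0 < κ ∧
    ∀ Q : PeriodicConfiguration 3,
      (∀ p ∈ Q.points, ∀ q ∈ Q.points, p ≠ q → (1 : ℝ) / 3 ≤ dist p q) →
      t * (Q.motif.card : ℝ) ≤
        (Nat.card {x : Q.motif // ¬ ∃ a : ℝ, 9 / 10 ≤ a ∧ a ≤ 1 ∧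
          ∃ T : Finset (EuclideanSpace ℝ (Fin 3)),
            (↑T : Set (EuclideanSpace ℝ (Fin 3))) =
              {w : EuclideanSpace ℝ (Fin 3) |
                w + (x : EuclideanSpace ℝ (Fin 3)) ∈ Q.points ∧ w ≠ 0 ∧ ‖w‖ ≤ (5 / 4 - θ) * a} ∧
            (ShellCloseTo (a / 100 + θ) T
               (Finset.image (fun v : EuclideanSpace ℝ (Fin 3) => a • v) fccKissingPattern) ∨
             ShellCloseTo (a / 100 + θ) T
               (Finset.image (fun v : EuclideanSpace ℝ (Fin 3) => a • v) hcpKissingPattern))} : ℝ) →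
      (⨅ R : PeriodicConfiguration 3, R.energyPerParticle lennardJones) + κ ≤ Q.energyPerParticle lennardJones

/-- **The conjecture IS `∀ θ ∈ (0, 1/10], Residual.ShellGap θ`** (the right-hand side of
`ExactResidual.minimiserShells_iff_shellGapAll`), by unfolding the residual vocabulary and `ShellNoBoundary.count_restrict_image_sub_singleton_ne_zero_iff`. -/
theorem lennardJonesShellGapConjecture_iff_shellGapAll :
    LennardJonesShellGapConjecture ↔ ∀ θ : ℝ, 0 < θ → θ ≤ 1 / 10 → ShellGap θ := by
  simp only [LennardJonesShellGapConjecture, ShellGap, IsSepThird, looseBadMotifCount, LooseGoodShell, rerooted, eStar,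
    count_restrict_image_sub_singleton_ne_zero_iff]

/-- **The crux `MinimiserShells` (stmt-AtomisticToContinuum-9225) is EQUIVALENT to `LennardJonesShellGapConjecture`**
(`ExactResidual.minimiserShells_iff_shellGapAll`, p149424: sufficiency through the loosened transfer chain and the boundary
lemma; necessity `Residual.shellGap_of_minimiserShells`, p123347, by uniformly rooted blocks). -/
theorem minimiserShells_iff_lennardJonesShellGapConjecture : MinimiserShells ↔ LennardJonesShellGapConjecture :=
  minimiserShells_iff_shellGapAll.trans lennardJonesShellGapConjecture_iff_shellGapAll.symm

/-- **The crux in Literature vocabulary** (registered marker `minimiserShells_iff_shellGapConjecture_explicit` on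
stmt-AtomisticToContinuum-9225): `MinimiserShells` is equivalent to the conjecture's defining statement, displayed. -/
theorem minimiserShells_iff_shellGapConjecture_explicit :
    MinimiserShells ↔ ∀ θ : ℝ, 0 < θ → θ ≤ 1 / 10 →
      ∀ t : ℝ, 0 < t → ∃ κ : ℝ, 0 < κ ∧
        ∀ Q : PeriodicConfiguration 3,
          (∀ p ∈ Q.points, ∀ q ∈ Q.points, p ≠ q → (1 : ℝ) / 3 ≤ dist p q) →
          t * (Q.motif.card : ℝ) ≤
            (Nat.card {x : Q.motif // ¬ ∃ a : ℝ, 9 / 10 ≤ a ∧ a ≤ 1 ∧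
              ∃ T : Finset (EuclideanSpace ℝ (Fin 3)),
                (↑T : Set (EuclideanSpace ℝ (Fin 3))) =
                  {w : EuclideanSpace ℝ (Fin 3) |
                    w + (x : EuclideanSpace ℝ (Fin 3)) ∈ Q.points ∧ w ≠ 0 ∧ ‖w‖ ≤ (5 / 4 - θ) * a} ∧
                (ShellCloseTo (a / 100 + θ) T
                   (Finset.image (fun v : EuclideanSpace ℝ (Fin 3) => a • v) fccKissingPattern) ∨
                 ShellCloseTo (a / 100 + θ) T
                   (Finset.image (fun v : EuclideanSpace ℝ (Fin 3) => a • v) hcpKissingPattern))} : ℝ) →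
          (⨅ R : PeriodicConfiguration 3, R.energyPerParticle lennardJones) + κ ≤ Q.energyPerParticle lennardJones :=
  minimiserShells_iff_lennardJonesShellGapConjecture

/-- **Glue for a conditional bridge**: `LennardJonesShellGapConjecture → MinimiserShells`.  A planner carrying the crux
conditionally on the conjecture can cite this theorem as the glue. -/
theorem minimiserShells_of_lennardJonesShellGapConjecture (h : LennardJonesShellGapConjecture) : MinimiserShells :=
  minimiserShells_iff_lennardJonesShellGapConjecture.2 h

/-- The exact gap `Residual.ShellGap 0` (registered residual stub S7⁗ of line `equilibrium-in-law-surgery`) implies the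
conjecture (`Residual.shellGap_mono`). -/
theorem lennardJonesShellGapConjecture_of_shellGap_zero (h : ShellGap 0) : LennardJonesShellGapConjecture :=
  lennardJonesShellGapConjecture_iff_shellGapAll.2 fun θ hθ hθ' => shellGap_mono 0 θ le_rfl hθ.le hθ' h

/-- **A countable family of levels suffices**: the conjecture holds iff `Residual.ShellGap (1/(n+10))` holds for every `n : ℕ`
(monotonicity of `ShellGap` in `θ` and the Archimedean property). -/
theorem lennardJonesShellGapConjecture_iff_nat :
    LennardJonesShellGapConjecture ↔ ∀ n : ℕ, ShellGap (1 / ((n : ℝ) + 10)) := by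
  rw [lennardJonesShellGapConjecture_iff_shellGapAll]
  constructor
  · intro h n
    have hn : (0 : ℝ) ≤ n := Nat.cast_nonneg n
    exact h _ (by positivity) (one_div_le_one_div_of_le (by norm_num) (by linarith))
  · intro h θ hθ hθ'
    obtain ⟨n, hn⟩ := exists_nat_gt (1 / θ)
    have hn0 : (0 : ℝ) ≤ n := Nat.cast_nonneg n
    have hle : 1 / ((n : ℝ) + 10) ≤ θ := by
      rw [div_le_iff₀ (by positivity)]
      have h1 : 1 / θ * θ = 1 := by field_simp
      nlinarith [mul_le_mul_of_nonneg_right hn.le hθ.le]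
    exact shellGap_mono _ θ (by positivity) hle hθ' (h n)

end Summit.AtomisticToContinuum.Crystallization

end
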